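import Mathlib
import Summits.PneNP.PneNP.Theorems.PstarGapLemma
import Summits.PneNP.PneNP.Theorems.PstarSAClosure
import Summits.PneNP.PneNP.Theorems.PstarGapPeeling
import Summits.PneNP.PneNP.Theorems.PstarGapSupport
import Summits.PneNP.PneNP.Theorems.PstarMinInfeasibleElim
import Summits.PneNP.PneNP.Theorems.PstarNoDeadCentre

/-!
# Chords: rigidity at `(1,1)` and repair with parity control (ROUND-24, tools for T24.16 `GapOneAnd`)

FRONTIER range-avoidance ladder (cell `pnp-ideate`, ROUND-24 gap-lemma programme; restricted-model combinatorics — nothing here bears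
on `P` versus `NP`).

Setting of T24.16 (`PstarNoDeadCentre.GapOneAnd`): a pure typed `P⋆` instance, ONE parity constraint `(C, b)` whose set `C` consists
of AND-type variables (`IsAndVar`), and a minimal `{(C,b)}`-infeasible output set `J`.  A CHORD of `J` is an output whose two AND slots
are `J`-private (`J`-boundary variables).  This file supplies the assignment-level calculus of memo §13 R10 (the part of item T24.14 that
T24.16 needs):

* parity bookkeeping under updates (`parity_update_of_mem`), and the XOR flip: flipping an XOR-type variable `t` toggles exactly the
  outputs reading `t` (`eval_flip_of_mem` / `eval_flip_of_not_mem`, via `Typed`);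
* `no_private_xor`: `J` has no `J`-private XOR slot (T24.13 (a) + `C` AND-typed); `chord_mem_C`: every chord carries a `C`-variable;
* RIGIDITY `chord_true`: in every solution of `J` both AND slots of every chord are `true` — otherwise re-tuning the private pair inside
  `{00, 01, 10}` (`retune`) flips `Σ_C` and keeps everything satisfied;
* REPAIR WITH PARITY CONTROL `repair_chords`: if the outputs of `J` outside a set `Q` of chords are satisfied, every chord in `Q` sits
  at `(1,1)` and is violated (its XOR side demands AND-bit `0`), then for either target parity `c` — provided `Q ≠ ∅` or the parity is
  already `c` — some assignment satisfies all of `J` with `Σ_C = c` (each chord is re-set to an AND-`0` pattern, and a chord with a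
  `C`-variable offers both parity changes from `(1,1)`).
-/

set_option linter.dupNamespace false -- `Summit.PneNP.PneNP.…`: summit = sub-problem name (D-0017 single-conjunct layout)

open Finset Literature.Computability.Complexity
open Summit.PneNP.PneNP.Theorems.PstarPDT (parity)
open Summit.PneNP.PneNP.Theorems.PstarTyped (Typed)
open Summit.PneNP.PneNP.Theorems.PstarSALevel (varSet bdry)
open Summit.PneNP.PneNP.Theorems.PstarGapLemma (Sat Feasible MinInfeasible)
open Summit.PneNP.PneNP.Theorems.PstarGapPeeling (not_mem_varSet_of_private eval_update_of_not_mem eval_update_xor_slot eval_pure)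
open Summit.PneNP.PneNP.Theorems.PstarGapSupport (parity_update_of_notMem)
open Summit.PneNP.PneNP.Theorems.PstarMinInfeasibleElim (xor_private_mem and_private_mem)
open Summit.PneNP.PneNP.Theorems.PstarNoDeadCentre (IsAndVar)

namespace Summit.PneNP.PneNP.Theorems.PstarChordRepair

variable {n m : ℕ}

/-! ## Parity bookkeeping -/

/-- Updating a variable INSIDE `C` changes the parity on `C` by `old ⊕ new`. -/
theorem parity_update_of_mem {C : Finset (Fin n)} {v : Fin n} (hv : v ∈ C) (z : Fin n → Bool) (a : Bool) :
    parity C (Function.update z v a) = xor (parity C z) (xor (z v) a) := by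
  classical
  unfold PstarPDT.parity
  have hcount : ∀ g : Fin n → Bool, (C.filter fun w => g w = true).card =
      ((C.erase v).filter fun w => g w = true).card + (if g v = true then 1 else 0) := by
    intro g
    have hsplit : (C.filter fun w => g w = true) =
        if g v = true then insert v ((C.erase v).filter fun w => g w = true) else (C.erase v).filter fun w => g w = true := by
      ext w
      by_cases hwv : w = v
      · subst hwv
        cases hg : g w <;> simp [hg, hv]
      · cases hg : g v <;> simp [hwv, mem_erase]
    have hnot : v ∉ (C.erase v).filter fun w => g w = true := fun h => (notMem_erase v C) (mem_filter.1 h).1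
    rw [hsplit]
    cases hg : g v
    · simp
    · simp [card_insert_of_notMem hnot]
  have hA : ((C.erase v).filter fun w => Function.update z v a w = true) = (C.erase v).filter fun w => z w = true := by
    refine filter_congr fun w hw => ?_
    rw [Function.update_of_ne (ne_of_mem_erase hw)]
  rw [hcount (Function.update z v a), hcount z, hA, Function.update_self]
  set N := ((C.erase v).filter fun w => z w = true).card with hN
  by_cases hodd : Odd N
  · have hne : ¬ Odd (N + 1) := fun h => by rw [Nat.odd_add_one] at h; exact h hodd
    cases hz : z v <;> cases a <;> simp [hodd, hne]
  · have hne : Odd (N + 1) := by rw [Nat.odd_add_one]; exact hodd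
    cases hz : z v <;> cases a <;> simp [hodd, hne]

/-- A single parity constraint `(C, b)` is satisfied iff the parity on `C` is `b`. -/
theorem sat_singleton_iff (C : Finset (Fin n)) (b : Bool) (z : Fin n → Bool) :
    Sat ({(C, b)} : Finset (Finset (Fin n) × Bool)) z ↔ parity C z = b := by
  unfold PstarGapLemma.Sat
  simp

/-! ## The XOR flip -/

/-- On a typed instance an XOR-slot variable is read by an output only through its XOR slots. -/
theorem xor_slot_of_mem_varSet (I : LocalMap 4 n m) (hT : Typed I) {j₀ : Fin m} {s₀ : Fin 4} (hs₀ : s₀.val < 2) {j : Fin m}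
    (h : I.vars j₀ s₀ ∈ varSet I j) : ∃ s : Fin 4, s.val < 2 ∧ I.vars j s = I.vars j₀ s₀ := by
  unfold PstarSALevel.varSet at h
  obtain ⟨s, -, hs⟩ := mem_image.1 h
  refine ⟨s, ?_, hs⟩
  by_contra hge
  push Not at hge
  exact hT j₀ j s₀ s hs₀ hge hs.symm

/-- **Flip, inside**: flipping an XOR-slot variable toggles an output that reads it. -/
theorem eval_flip_of_mem (I : LocalMap 4 n m) (hI : I.IsPure xorAndPred) (hT : Typed I) {j₀ : Fin m} {s₀ : Fin 4}
    (hs₀ : s₀.val < 2) (z : Fin n → Bool) {j : Fin m} (h : I.vars j₀ s₀ ∈ varSet I j) :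
    I.eval (Function.update z (I.vars j₀ s₀) (!z (I.vars j₀ s₀))) j = !I.eval z j := by
  obtain ⟨s, hs, hse⟩ := xor_slot_of_mem_varSet I hT hs₀ h
  rw [← hse]
  exact eval_update_xor_slot I hI z j s hs

/-- **Flip, outside**: flipping a variable an output does not read leaves it unchanged. -/
theorem eval_flip_of_not_mem (I : LocalMap 4 n m) (z : Fin n → Bool) {v : Fin n} {j : Fin m} (h : v ∉ varSet I j) (a : Bool) :
    I.eval (Function.update z v a) j = I.eval z j :=
  eval_update_of_not_mem I j z h a

/-! ## Chords of a minimal infeasible set under one AND-typed parity -/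

section OneParity

variable (I : LocalMap 4 n m) {y : Fin m → Bool} {C : Finset (Fin n)} {b : Bool} {J : Finset (Fin m)}

/-- `j` is a CHORD of `J`: both its AND slots are `J`-boundary (= `J`-private) variables. -/
def IsChord (J : Finset (Fin m)) (j : Fin m) : Prop := I.vars j 2 ∈ bdry I J ∧ I.vars j 3 ∈ bdry I J

/-- An XOR-slot variable is not AND-typed. -/
theorem not_isAndVar_xor_slot (j : Fin m) (s : Fin 4) (hs : s.val < 2) : ¬ IsAndVar I (I.vars j s) :=
  fun h => h j s hs rfl

/-- **No private XOR slot** (T24.13 (a), with `C` AND-typed): in a minimal `{(C,b)}`-infeasible `J` no XOR slot is a `J`-boundary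
variable. -/
theorem no_private_xor (hI : I.IsPure xorAndPred) (hC : ∀ v ∈ C, IsAndVar I v) (hmin : MinInfeasible I y {(C, b)} J) {j : Fin m} (hj : j ∈ J) (s : Fin 4)
    (hs : s.val < 2) : I.vars j s ∉ bdry I J :=
  fun hb => not_isAndVar_xor_slot I j s hs (hC _ (xor_private_mem I hI hmin hj s hs hb))

/-- **Every chord carries a `C`-variable** (T24.13 (b)). -/
theorem chord_mem_C (hI : I.IsPure xorAndPred) (hmin : MinInfeasible I y {(C, b)} J) {j : Fin m} (hj : j ∈ J) (hc : IsChord I J j) :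
    I.vars j 2 ∈ C ∨ I.vars j 3 ∈ C :=
  and_private_mem I hI hmin hj hc.1 hc.2

/-- Re-setting the private AND pair of a chord: the other outputs of `J` do not move. -/
theorem eval_setPair_of_ne {j j' : Fin m} (hj : j ∈ J) (hj' : j' ∈ J) (hne : j' ≠ j) (hc : IsChord I J j) (z : Fin n → Bool)
    (a a' : Bool) : I.eval (Function.update (Function.update z (I.vars j 2) a) (I.vars j 3) a') j' = I.eval z j' := by
  have h3 : I.vars j 3 ∉ varSet I j' := not_mem_varSet_of_private I hj hj' hne hc.2 (mem_image.2 ⟨3, mem_univ _, rfl⟩)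
  have h2 : I.vars j 2 ∉ varSet I j' := not_mem_varSet_of_private I hj hj' hne hc.1 (mem_image.2 ⟨2, mem_univ _, rfl⟩)
  rw [eval_update_of_not_mem I j' _ h3, eval_update_of_not_mem I j' _ h2]

/-- Re-setting the AND pair of `j` to `(a, a')` gives output `j` the value `u₀ ⊕ u₁ ⊕ (a ∧ a')`. -/
theorem eval_setPair_self (hI : I.IsPure xorAndPred) (j : Fin m) (z : Fin n → Bool) (a a' : Bool) :
    I.eval (Function.update (Function.update z (I.vars j 2) a) (I.vars j 3) a') j =
      xor (xor (z (I.vars j 0)) (z (I.vars j 1))) (a && a') := by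
  have hinj := hI.2 j
  have hne : ∀ t t' : Fin 4, t ≠ t' → I.vars j t ≠ I.vars j t' := fun t t' ht h => ht (hinj h)
  rw [eval_pure I hI]
  rw [Function.update_of_ne (hne 0 3 (by decide)), Function.update_of_ne (hne 0 2 (by decide)),
    Function.update_of_ne (hne 1 3 (by decide)), Function.update_of_ne (hne 1 2 (by decide)),
    Function.update_self, Function.update_of_ne (hne 2 3 (by decide)), Function.update_self]

/-- Parity after re-setting the AND pair of `j`: it changes by the `C`-weighted flips of the two slots. -/
theorem parity_setPair (hI : I.IsPure xorAndPred) (j : Fin m) (z : Fin n → Bool) (a a' : Bool) :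
    parity C (Function.update (Function.update z (I.vars j 2) a) (I.vars j 3) a') =
      xor (parity C z) (xor (decide (I.vars j 2 ∈ C) && xor (z (I.vars j 2)) a)
        (decide (I.vars j 3 ∈ C) && xor (z (I.vars j 3)) a')) := by
  classical
  have hinj := hI.2 j
  have h23 : I.vars j 3 ≠ I.vars j 2 := fun h => absurd (hinj h) (by decide)
  have step2 : parity C (Function.update z (I.vars j 2) a) =
      xor (parity C z) (decide (I.vars j 2 ∈ C) && xor (z (I.vars j 2)) a) := by
    by_cases h2 : I.vars j 2 ∈ C
    · rw [parity_update_of_mem h2]; simp [h2]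
    · rw [parity_update_of_notMem h2]; simp [h2]
  have hz3 : Function.update z (I.vars j 2) a (I.vars j 3) = z (I.vars j 3) := Function.update_of_ne h23 _ _
  by_cases h3 : I.vars j 3 ∈ C
  · rw [parity_update_of_mem h3, hz3, step2]
    simp only [h3, decide_true, Bool.true_and]
    cases parity C z <;> cases (decide (I.vars j 2 ∈ C) && xor (z (I.vars j 2)) a) <;> cases xor (z (I.vars j 3)) a' <;> rfl
  · rw [parity_update_of_notMem h3, step2]
    simp [h3]

/-- **Re-tuning**: a chord with a `C`-variable whose AND-bit is `0` can be re-set inside `{00, 01, 10}` so that `Σ_C` flips. -/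
theorem retune (hI : I.IsPure xorAndPred) (hmin : MinInfeasible I y {(C, b)} J) {j : Fin m} (hj : j ∈ J) (hc : IsChord I J j) (z : Fin n → Bool)
    (h0 : (z (I.vars j 2) && z (I.vars j 3)) = false) :
    ∃ a a' : Bool, (a && a') = false ∧
      parity C (Function.update (Function.update z (I.vars j 2) a) (I.vars j 3) a') = !parity C z := by
  have hC := chord_mem_C I hI hmin hj hc
  have key : ∀ (p2 p3 z2 z3 : Bool), (p2 = true ∨ p3 = true) → (z2 && z3) = false →
      ∃ a a' : Bool, (a && a') = false ∧ (xor (p2 && xor z2 a) (p3 && xor z3 a')) = true := by decide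
  obtain ⟨a, a', haa, hx⟩ := key (decide (I.vars j 2 ∈ C)) (decide (I.vars j 3 ∈ C)) (z (I.vars j 2)) (z (I.vars j 3))
    (by rcases hC with h | h <;> simp [h]) h0
  refine ⟨a, a', haa, ?_⟩
  rw [parity_setPair I hI, hx]
  cases parity C z <;> rfl

/-- **Rigidity of chords**: in every solution of a minimal `{(C,b)}`-infeasible `J`, both AND slots of every chord are `true`. -/
theorem chord_true (hI : I.IsPure xorAndPred) (hmin : MinInfeasible I y {(C, b)} J) {z : Fin n → Bool} (hz : ∀ j ∈ J, I.eval z j = y j) {j : Fin m}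
    (hj : j ∈ J) (hc : IsChord I J j) : z (I.vars j 2) = true ∧ z (I.vars j 3) = true := by
  by_contra hnot
  have h0 : (z (I.vars j 2) && z (I.vars j 3)) = false := by
    revert hnot
    cases z (I.vars j 2) <;> cases z (I.vars j 3) <;> simp
  obtain ⟨a, a', haa, hpar⟩ := retune I hI hmin hj hc z h0
  -- the re-tuned assignment still solves `J` and has the other parity; one of the two parities is `b`
  set z' := Function.update (Function.update z (I.vars j 2) a) (I.vars j 3) a' with hz'
  have hz'sol : ∀ j' ∈ J, I.eval z' j' = y j' := by
    intro j' hj'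
    by_cases h : j' = j
    · subst h
      rw [hz', eval_setPair_self I hI, haa, ← hz j' hj', eval_pure I hI, h0]
    · rw [hz', eval_setPair_of_ne I hj hj' h hc]
      exact hz j' hj'
  apply hmin.1
  by_cases hb : parity C z = b
  · exact ⟨z, (sat_singleton_iff C b z).2 hb, hz⟩
  · refine ⟨z', (sat_singleton_iff C b z').2 ?_, hz'sol⟩
    rw [hpar]
    revert hb
    cases parity C z <;> cases b <;> simp

/-! ## Repair with parity control -/

/-- From `(1,1)`, a chord with a `C`-variable can be re-set to an AND-`0` pattern with EITHER parity change. -/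
theorem reset_choice (hI : I.IsPure xorAndPred) (hmin : MinInfeasible I y {(C, b)} J) {j : Fin m} (hj : j ∈ J) (hc : IsChord I J j) (z : Fin n → Bool)
    (h2 : z (I.vars j 2) = true) (h3 : z (I.vars j 3) = true) (δ : Bool) :
    ∃ a a' : Bool, (a && a') = false ∧
      parity C (Function.update (Function.update z (I.vars j 2) a) (I.vars j 3) a') = xor (parity C z) δ := by
  have hC := chord_mem_C I hI hmin hj hc
  have key : ∀ (p2 p3 δ : Bool), (p2 = true ∨ p3 = true) →
      ∃ a a' : Bool, (a && a') = false ∧ (xor (p2 && xor true a) (p3 && xor true a')) = δ := by decide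
  obtain ⟨a, a', haa, hx⟩ := key (decide (I.vars j 2 ∈ C)) (decide (I.vars j 3 ∈ C)) δ
    (by rcases hC with h | h <;> simp [h])
  refine ⟨a, a', haa, ?_⟩
  rw [parity_setPair I hI, h2, h3, hx]

/-- **Repair of violated chords with parity control.**  Let `Q ⊆ J` consist of chords, each violated at `z` and sitting at `(1,1)`,
while every other output of `J` is satisfied at `z`.  Then for every target parity `c` with `Q ≠ ∅ ∨ parity C z = c` some assignment
satisfies all of `J` with `Σ_C = c`. -/
theorem repair_chords (hI : I.IsPure xorAndPred) (hmin : MinInfeasible I y {(C, b)} J) :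
    ∀ (Q : Finset (Fin m)) (z : Fin n → Bool), Q ⊆ J → (∀ j ∈ Q, IsChord I J j) →
      (∀ j ∈ Q, I.eval z j ≠ y j ∧ z (I.vars j 2) = true ∧ z (I.vars j 3) = true) →
      (∀ j ∈ J, j ∉ Q → I.eval z j = y j) → ∀ c : Bool, (Q.Nonempty ∨ parity C z = c) →
      ∃ z' : Fin n → Bool, (∀ j ∈ J, I.eval z' j = y j) ∧ parity C z' = c := by
  classical
  intro Q
  induction Q using Finset.strongInduction with
  | H Q ih =>
    intro z hQJ hch hviol hrest c hc
    rcases Q.eq_empty_or_nonempty with rfl | hne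
    · refine ⟨z, fun j hj => hrest j hj (notMem_empty j), ?_⟩
      rcases hc with h | h
      · exact absurd h Finset.not_nonempty_empty
      · exact h
    obtain ⟨j, hjQ⟩ := hne
    have hj : j ∈ J := hQJ hjQ
    obtain ⟨hvj, h2, h3⟩ := hviol j hjQ
    -- the parity change at `j`: whatever is still needed if `j` is the last chord, anything otherwise
    set δ := xor (parity C z) c with hδ
    obtain ⟨a, a', haa, hpar⟩ := reset_choice I hI hmin hj (hch j hjQ) z h2 h3 δ
    set z₁ := Function.update (Function.update z (I.vars j 2) a) (I.vars j 3) a' with hz₁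
    have hpar₁ : parity C z₁ = c := by
      rw [hz₁, hpar, hδ]
      cases parity C z <;> cases c <;> rfl
    have hfix : I.eval z₁ j = y j := by
      rw [hz₁, eval_setPair_self I hI, haa]
      have h := hvj
      rw [eval_pure I hI, h2, h3] at h
      revert h
      cases z (I.vars j 0) <;> cases z (I.vars j 1) <;> cases y j <;> simp
    have hother : ∀ j' ∈ J, j' ≠ j → I.eval z₁ j' = I.eval z j' := fun j' hj' hne' =>
      eval_setPair_of_ne I hj hj' hne' (hch j hjQ) z a a'
    have hval : ∀ j' ∈ J, j' ≠ j → z₁ (I.vars j' 2) = z (I.vars j' 2) ∧ z₁ (I.vars j' 3) = z (I.vars j' 3) := by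
      intro j' hj' hne'
      have hc := hch j hjQ
      have n2 : ∀ s : Fin 4, I.vars j' s ≠ I.vars j 2 := fun s h =>
        not_mem_varSet_of_private I hj hj' hne' hc.1 (mem_image.2 ⟨2, mem_univ _, rfl⟩) (h ▸ mem_image.2 ⟨s, mem_univ _, rfl⟩)
      have n3 : ∀ s : Fin 4, I.vars j' s ≠ I.vars j 3 := fun s h =>
        not_mem_varSet_of_private I hj hj' hne' hc.2 (mem_image.2 ⟨3, mem_univ _, rfl⟩) (h ▸ mem_image.2 ⟨s, mem_univ _, rfl⟩)
      rw [hz₁]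
      constructor
      · rw [Function.update_of_ne (n3 2), Function.update_of_ne (n2 2)]
      · rw [Function.update_of_ne (n3 3), Function.update_of_ne (n2 3)]
    obtain ⟨z', hz', hc'⟩ := ih (Q.erase j) (erase_ssubset hjQ) z₁ ((erase_subset j Q).trans hQJ)
      (fun j' hj' => hch j' (mem_of_mem_erase hj'))
      (fun j' hj' => by
        have hne' : j' ≠ j := ne_of_mem_erase hj'
        have hj'Q : j' ∈ Q := mem_of_mem_erase hj'
        obtain ⟨hv', h2', h3'⟩ := hviol j' hj'Q
        obtain ⟨e2, e3⟩ := hval j' (hQJ hj'Q) hne'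
        rw [hother j' (hQJ hj'Q) hne', e2, e3]
        exact ⟨hv', h2', h3'⟩)
      (fun j' hj' hnot => by
        by_cases h : j' = j
        · rw [h]; exact hfix
        · rw [hother j' hj' h]
          exact hrest j' hj' (fun hq => hnot (mem_erase.2 ⟨h, hq⟩)))
      c (Or.inr hpar₁)
    exact ⟨z', hz', hc'⟩

end OneParity

end Summit.PneNP.PneNP.Theorems.PstarChordRepair
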